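/-
certnum (FRONTIER certnum, D-0105 (6)) — L4 bridge hardening, certnum-lean-1: assembling a doubleton chain check from
per-stage checks proved in SEPARATE declarations / files (the shape multi-file kernel replays of cap-ode-cert/2
certificates need; see `Literature/Computation/Certificates/CapOdeDoubletonReplay.lean`).
-/
import Literature.Analysis.ODE.ElementaryFieldDoubletonChainCertificate
import HarnessLib

/-!
# Doubleton chain checks assembled from per-stage checks

`ElementaryFieldDoubletonChainCertificate.lean` proves the forward direction `EDChainCert.edChainCheck_spec`
(the chain test implies every stage test).  This companion file proves the CONVERSE — if every stage
`j < N` checks against node `j + 1` (the last against the final node) then `edChainCheck … = true` —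
in the list form `edChainCheck_of_forall` and in the certificate vocabulary
`EDChainCert.check_of_forall` (`stageAt` / `nodeAt`).  Purpose: a long transcript (tens of stages,
each ≈ 10–90 s of kernel time) can be replayed with ONE `decide +kernel` theorem per stage, spread over
several files under the gate's single-file elaboration budget, and the chain check is then assembled
by `check_of_forall` + `interval_cases` in seconds, without unrolling `edChainCheck` by `simp`.
Also packaged here, for the same multi-file use: `EDChainCert.mem_apriori_of_box` (the a-priori box
`[Sⱼ]` on `[τⱼ, τⱼ₊₁]` from a BOX of initial values — the second conclusion of `EDChainCert.sound`,
companion of `mem_hull_of_box`) and `EDChainCert.exists_of_box` (existence on `[0, τ_N]`).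
No new mathematics; structural induction on the stage list mirroring `EDChainCert.edChainCheck_spec`
and two repackagings of `EDChainCert.sound`.
NOT COVERED: nothing about soundness changes — `EDChainCert.sound` / `eDoubletonChainVerifier` are
used as they are.
-/

open Set NonemptyInterval Matrix
open scoped Pointwise
open Literature.Analysis.ValidatedNumerics Literature.Analysis.ValidatedNumerics.ITaylor
open Literature.Analysis.ODE.FExpr

namespace Literature.Analysis.ODE

variable {n : ℕ}

/-- Converse of `EDChainCert.edChainCheck_spec`: if every stage of the list checks against the next node (the
last one against `fin`), the decidable chain test `edChainCheck` passes.
[cite: MrozekZgliczynski2000, Lemma 8.5] -/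
theorem edChainCheck_of_forall {F : Fin n → FExpr n} {cfg : SeedCfg} {R0 : Fin n → Iv}
    {fin : DNode n} (pad : EDStage n) :
    ∀ l : List (EDStage n),
      (∀ j < l.length,
        (l.getD j pad).stepCheck F cfg R0 ((l.map EDStage.node).getD (j + 1) fin) = true) →
      edChainCheck F cfg R0 fin l = true
  | [], _ => rfl
  | s :: rest, h => by
    simp only [edChainCheck, Bool.and_eq_true]
    refine ⟨?_, edChainCheck_of_forall pad rest fun j hj => ?_⟩
    · have h0 := h 0 (by simp)
      simp only [List.getD_cons_zero, List.map_cons, List.getD_cons_succ, zero_add] at h0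
      cases rest with
      | nil => simpa [edNext] using h0
      | cons s' rest' => simpa [edNext] using h0
    · have := h (j + 1) (by simpa using hj)
      simpa only [List.getD_cons_succ, List.map_cons] using this

/-- `edChainCheck` holds iff every stage checks against the next node.
[cite: MrozekZgliczynski2000, Lemma 8.5] -/
theorem edChainCheck_iff_forall {F : Fin n → FExpr n} {cfg : SeedCfg} {R0 : Fin n → Iv}
    {fin : DNode n} (pad : EDStage n) (l : List (EDStage n)) :
    edChainCheck F cfg R0 fin l = true ↔
      ∀ j < l.length,
        (l.getD j pad).stepCheck F cfg R0 ((l.map EDStage.node).getD (j + 1) fin) = true :=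
  ⟨fun h => EDChainCert.edChainCheck_spec l h, edChainCheck_of_forall pad l⟩

/-- **Chain check from per-stage checks** (certificate vocabulary): if stage `j` checks against node
`j + 1` for every `j < N` (node `N` = the final node), then `c.check = true`.  With the stage checks
proved as separate theorems `hⱼ`, use
`EDChainCert.check_of_forall c (fun j hj => by interval_cases j <;> assumption)`-style scripts.
[cite: MrozekZgliczynski2000, Lemma 8.5] -/
theorem EDChainCert.check_of_forall (c : EDChainCert n)
    (h : ∀ j < c.size, (c.stageAt j).stepCheck c.field c.cfg c.r0 (c.nodeAt (j + 1)) = true) :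
    c.check = true :=
  edChainCheck_of_forall c.padStage c.stages h

/-- … and conversely (restating `EDChainCert.check_stage` as an `iff`).
[cite: MrozekZgliczynski2000, Lemma 8.5] -/
theorem EDChainCert.check_iff_forall (c : EDChainCert n) :
    c.check = true ↔
      ∀ j < c.size, (c.stageAt j).stepCheck c.field c.cfg c.r0 (c.nodeAt (j + 1)) = true :=
  ⟨fun hc _ hj => c.check_stage hc hj, c.check_of_forall⟩

/-- **A-priori boxes between mesh points, from a box of initial values** (the companion of
`EDChainCert.mem_hull_of_box` for the second conclusion of `EDChainCert.sound`): if `C₀ = 1`,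
`0 ∈ [R₀]` and `W − x₀ ⊆ [R⁰]`, every solution from `y₀ ∈ W` on `[0, τ_N]` stays, on each
`[τⱼ, τⱼ₊₁]` (`j < N`), inside the stage's a-priori box `[Sⱼ]` — the literal `apriori` field of
stage `j`, so per-stage state bounds over the sub-intervals are read off the certificate.
[cite: MrozekZgliczynski2000, §7.5 Lemma 7.6] [cite: Moore1979, §8.1 eq. (8.13)] -/
theorem EDChainCert.mem_apriori_of_box (c : EDChainCert n) (hc : c.check = true)
    (hC : isOneQ (c.nodeAt 0).cmat = true) (hR : boxLE (pointBox 0) (c.nodeAt 0).rem = true)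
    {W : Fin n → Iv} (hW : boxLE (shiftBox W (c.nodeAt 0).center) c.r0 = true)
    {y : ℝ → Fin n → ℝ} (hy0 : y 0 ∈ boxSet (castBox W))
    (hy : ∀ t ∈ Icc (0 : ℝ) (c.toHOEChain.mesh c.size),
      HasDerivWithinAt y (fieldFun c.field (y t)) (Icc (0 : ℝ) (c.toHOEChain.mesh c.size)) t)
    {j : ℕ} (hj : j < c.size) {t : ℝ} (ht : t ∈ Icc (c.toHOEChain.mesh j) (c.toHOEChain.mesh (j + 1))) :
    y t ∈ boxSet (castBox (c.stageAt j).apriori) :=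
  ((c.sound hc (boxSet_mono (castBox_mono (le_of_boxLE hW))
      (mem_boxSet_iff.2 fun l => sub_mem_shiftBox hy0 l))
    (DNode.start_mem hC hR (y 0))).2 y rfl hy).2 j hj t ht

/-- **Existence on `[0, τ_N]` from a box of initial values** (first conclusion of
`EDChainCert.sound`, packaged like `mem_hull_of_box`). [cite: MrozekZgliczynski2000, Lemma 8.5]
[cite: Moore1979, §8.1 eq. (8.13)] -/
theorem EDChainCert.exists_of_box (c : EDChainCert n) (hc : c.check = true)
    (hC : isOneQ (c.nodeAt 0).cmat = true) (hR : boxLE (pointBox 0) (c.nodeAt 0).rem = true)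
    {W : Fin n → Iv} (hW : boxLE (shiftBox W (c.nodeAt 0).center) c.r0 = true)
    {y₀ : Fin n → ℝ} (hy₀ : y₀ ∈ boxSet (castBox W)) :
    ∃ y : ℝ → Fin n → ℝ, y 0 = y₀ ∧
      ∀ t ∈ Icc (0 : ℝ) (c.toHOEChain.mesh c.size),
        HasDerivWithinAt y (fieldFun c.field (y t)) (Icc (0 : ℝ) (c.toHOEChain.mesh c.size)) t :=
  (c.sound hc (boxSet_mono (castBox_mono (le_of_boxLE hW))
      (mem_boxSet_iff.2 fun l => sub_mem_shiftBox hy₀ l))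
    (DNode.start_mem hC hR y₀)).1

/-! ### Mesh monotonicity and the covering of `[0, τ_N]` by the sub-intervals (appended 2026-08-27, certnum-lean-1)

For a client hypothesis of the shape «for ALL `t ∈ [0, T]` the state lies below a ceiling» one needs,
besides `mem_apriori_of_box`, that every `t ∈ [0, τ_N]` lies in SOME `[τⱼ, τⱼ₊₁]`; this follows from
`τ₀ = 0` and `τⱼ ≤ τⱼ₊₁`, the latter being part of what each stage check certifies (`0 ≤ hⱼ`). -/

/-- Steps of the underlying transcript are the stages' steps (bookkeeping). [folklore] -/
private theorem EDChainCert.toHOEChain_stageAt_step (c : EDChainCert n) (j : ℕ) :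
    (c.toHOEChain.stageAt j).step = (c.stageAt j).step := by
  have h : c.toHOEChain.stageAt j = (c.stageAt j).toHOEStage := by
    show (c.stages.map EDStage.toHOEStage).getD j (EDStage.toHOEStage c.padStage) = _
    rw [List.getD_map]
    rfl
  rw [h]; rfl

/-- **The mesh is monotone** along a checked chain: `τⱼ ≤ τⱼ₊₁` for `j < N` (each stage check
certifies `0 ≤ hⱼ`). [cite: Moore1979, §8.1 eq. (8.13)] -/
theorem EDChainCert.mesh_le_succ (c : EDChainCert n) (hc : c.check = true) {j : ℕ} (hj : j < c.size) :
    c.toHOEChain.mesh j ≤ c.toHOEChain.mesh (j + 1) := by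
  have hE : ((c.stageAt j).cert c.field c.cfg).toE.check = true :=
    (EVarStepCert.check_spec (EMVStepCert.check_spec
      (EDStage.stepCheck_spec (c.check_stage hc hj)).1).1).1
  rw [HOEChainCert.mesh_succ, c.toHOEChain_stageAt_step]
  exact le_add_of_nonneg_right (EStepCert.check_spec hE).2.1

/-- Monotonicity between arbitrary mesh indices `i ≤ j ≤ N`. [cite: Moore1979, §8.1 eq. (8.13)] -/
theorem EDChainCert.mesh_mono (c : EDChainCert n) (hc : c.check = true) {i j : ℕ} (hij : i ≤ j)
    (hjN : j ≤ c.size) : c.toHOEChain.mesh i ≤ c.toHOEChain.mesh j := by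
  induction j with
  | zero => simp [Nat.le_zero.1 hij]
  | succ j ih =>
    rcases Nat.of_le_succ hij with hij' | hij'
    · exact (ih hij' (Nat.le_of_succ_le hjN)).trans (c.mesh_le_succ hc (Nat.lt_of_succ_le hjN))
    · rw [hij']

/-- **Every time in `[0, τ_N]` lies in some sub-interval `[τ_k, τ_(k+1)]`, `k < N`** (for a
transcript with at least one stage; no monotonicity needed: take the largest `k` with `τ_k ≤ t`).
[cite: Moore1979, §8.1 eq. (8.13)] -/
theorem EDChainCert.exists_mesh_Icc (c : EDChainCert n) (hN : 0 < c.size)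
    {t : ℝ} (ht : t ∈ Icc (0 : ℝ) (c.toHOEChain.mesh c.size)) :
    ∃ k < c.size, t ∈ Icc (c.toHOEChain.mesh k) (c.toHOEChain.mesh (k + 1)) := by
  -- the largest k ≤ N - 1 with τ_k ≤ t
  classical
  have h0 : c.toHOEChain.mesh 0 ≤ t := by rw [HOEChainCert.mesh_zero]; exact ht.1
  let P : ℕ → Prop := fun k => k < c.size ∧ c.toHOEChain.mesh k ≤ t
  have hP0 : P 0 := ⟨hN, h0⟩
  let k := Nat.findGreatest P (c.size - 1)
  have hk : P k := Nat.findGreatest_spec (Nat.zero_le _) hP0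
  refine ⟨k, hk.1, hk.2, ?_⟩
  by_cases hk1 : k + 1 < c.size
  · by_contra hlt
    have hP : P (k + 1) := ⟨hk1, (lt_of_not_ge hlt).le⟩
    have hle : k + 1 ≤ c.size - 1 := by omega
    have := Nat.le_findGreatest hle hP
    omega
  · have hk2 : k + 1 = c.size := by omega
    rw [hk2]; exact ht.2

/-- **A-priori boxes cover the whole time interval** (from a box of initial values): every solution
from `y₀ ∈ W` on `[0, τ_N]` lies, at EVERY `t ∈ [0, τ_N]`, in the a-priori box of SOME stage `k < N`.
[cite: MrozekZgliczynski2000, §7.5 Lemma 7.6] [cite: Moore1979, §8.1 eq. (8.13)] -/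
theorem EDChainCert.exists_mem_apriori_of_box (c : EDChainCert n) (hc : c.check = true) (hN : 0 < c.size)
    (hC : isOneQ (c.nodeAt 0).cmat = true) (hR : boxLE (pointBox 0) (c.nodeAt 0).rem = true)
    {W : Fin n → Iv} (hW : boxLE (shiftBox W (c.nodeAt 0).center) c.r0 = true)
    {y : ℝ → Fin n → ℝ} (hy0 : y 0 ∈ boxSet (castBox W))
    (hy : ∀ t ∈ Icc (0 : ℝ) (c.toHOEChain.mesh c.size),
      HasDerivWithinAt y (fieldFun c.field (y t)) (Icc (0 : ℝ) (c.toHOEChain.mesh c.size)) t)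
    {t : ℝ} (ht : t ∈ Icc (0 : ℝ) (c.toHOEChain.mesh c.size)) :
    ∃ k < c.size, y t ∈ boxSet (castBox (c.stageAt k).apriori) := by
  obtain ⟨k, hk, hkt⟩ := c.exists_mesh_Icc hN ht
  exact ⟨k, hk, c.mem_apriori_of_box hc hC hR hW hy0 hy hk hkt⟩

end Literature.Analysis.ODE
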